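import Summits.NavierStokesRegularity.NavierStokesRegularity.Theses.LevelSetModeration
import Summits.NavierStokesRegularity.NavierStokesRegularity.Theorems.Target.Negative.EnergyClassLoadBearing
import Literature.Analysis.FluidPDE.NormalisedPressureAffine

/-!
# Crux `LevelSetClosure` (stmt-NavierStokesRegularity-18150), negative side:
# the Leray–Hopf (finite-energy) hypothesis is load-bearing

Route `LevelSetModeration`, crux 3 `LevelSetClosure` (`Phi_controls`): a classical solution of unforced
Navier–Stokes on `ℝ³ × [0, T)`, Leray–Hopf on `[0, T]` from the rapidly decaying datum `u 0`, whose
one-sided pressure-work pairing on speed super-level sets obeys the sub-generic bound of crux 2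
(`m < 10/3`), is bounded on `[0, T)`.

* `LevelSetClosureWithoutLerayHopf` — the crux with the hypothesis `IsLerayHopfOn T ν 0 (u 0) u`
  DELETED, everything else verbatim.
* `levelSetClosure_false_without_lerayHopf` — that weakening is FALSE. Witness: the accelerating
  Galilean drift of Koch–Nadirashvili–Seregin–Šverák (Acta Math. 203 (2009), §1 p. 3, "parasitic
  solutions") `u(t, x) = -log(1 - t) e₀`, `p = -(1 - t)⁻¹ x₀`, `ν = T = 1` (tree:
  `Target.Negative.driftVel`, `isClassical_drift`): classical on `[0, 1)`, from rest (Schwartz datum),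
  `‖u(t, 0)‖ → ∞` as `t ↑ 1`; and the pressure-work hypothesis holds for EVERY `m, Λ, M₀` because the
  normalised pressure `p̃ = R_iR_j(u_iu_j)` of a spatially constant slice is a spatially constant
  function (affine covariance `normalisedPressure_comp_affine`, junk branch included), so
  `∇p̃ ≡ 0` and the pairing vanishes identically: `p̃` is blind to the harmonic (here linear) physical
  pressure that drives the acceleration. Hence any proof of the crux must use the energy class —
  in the intended proof through `∇p = ∇p̃` (Tao's pressure normalisation) and the level-set energy
  inequality. Classification if it were the crux: refuted-misstated (missing finite-energy
  normalisation); the crux itself carries the clause, so nothing is refuted.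
Nothing here closes the item (`--supports`).
-/

noncomputable section

open MeasureTheory TopologicalSpace Set Function Filter Metric
open scoped Topology RealInnerProductSpace
open Literature.Analysis.FluidPDE
open Summit.NavierStokesRegularity.NavierStokesRegularity.Theorems.Target.Negative

namespace Summit.NavierStokesRegularity.NavierStokesRegularity.Theorems.LevelSetClosure.Negative

/-- Local notation for physical space `ℝ³ = EuclideanSpace ℝ (Fin 3)`. -/
local notation "ℝ³" => EuclideanSpace ℝ (Fin 3)

/-- The crux `LevelSetModeration.LevelSetClosure` with the Leray–Hopf hypothesis
`IsLerayHopfOn T ν 0 (u 0) u` DELETED (everything else verbatim). -/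
def LevelSetClosureWithoutLerayHopf : Prop :=
  ∀ (ν T : ℝ), 0 < ν → 0 < T → ∀ (u : ℝ → ℝ³ → ℝ³) (p : ℝ → ℝ³ → ℝ),
    IsClassicalNSSolutionOn (Set.Ico 0 T) ν 0 u p → HasRapidSpatialDecay (u 0) →
    ∀ (m Λ M₀ : ℝ), m < 10 / 3 → 0 < M₀ → (∀ x, ‖u 0 x‖ ≤ M₀ / 2) →
    (∀ (M c t : ℝ), M₀ ≤ M → M / 2 ≤ c → c ≤ M → 0 < c → t ∈ Set.Ico 0 T →
      -(∫ τ in Set.Ioo 0 t, ∫ x, max (1 - c / ‖u τ x‖) 0 *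
          (fderiv ℝ (normalisedPressure (u τ)) x (u τ x))) ≤
        Real.sqrt (Λ * M ^ m * (∫⁻ τ in Set.Ioo 0 T, volume {x | c < ‖u τ x‖}).toReal) *
        Real.sqrt ((∫⁻ τ in Set.Ioo 0 T, ∫⁻ x, Set.indicator {x | c < ‖u τ x‖}
          (fun x => ENNReal.ofReal (‖fderiv ℝ (fun y => ‖u τ y‖) x‖ ^ 2)) x).toReal)) →
    ∃ B : ℝ, ∀ t ∈ Set.Ico 0 T, ∀ x, ‖u t x‖ ≤ B

/-- **The normalised pressure of a spatially constant slice is spatially constant** (both the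
principal-value branch and the junk branch): translation covariance of `p̃`. -/
theorem normalisedPressure_const_apply (v x₀ : ℝ³) :
    normalisedPressure (fun _ : ℝ³ => v) x₀ = normalisedPressure (fun _ : ℝ³ => v) 0 := by
  have h := normalisedPressure_comp_affine (fun _ : ℝ³ => v) x₀ one_pos 0
  simpa using h.symm

/-- Hence `∇p̃ ≡ 0` for a spatially constant slice. -/
theorem fderiv_normalisedPressure_const (v x : ℝ³) :
    fderiv ℝ (normalisedPressure (fun _ : ℝ³ => v)) x = 0 := by
  have hfun : normalisedPressure (fun _ : ℝ³ => v) =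
      fun _ => normalisedPressure (fun _ : ℝ³ => v) 0 :=
    funext fun y => normalisedPressure_const_apply v y
  rw [hfun]
  simp

/-- The pressure-work integrand of the crux vanishes identically along the drift flow. -/
theorem pressureWork_integrand_drift (c τ : ℝ) (x : ℝ³) :
    max (1 - c / ‖driftVel τ x‖) 0 *
      (fderiv ℝ (normalisedPressure (driftVel τ)) x (driftVel τ x)) = 0 := by
  have h : fderiv ℝ (normalisedPressure (driftVel τ)) x = 0 :=
    fderiv_normalisedPressure_const (driftAmp τ • e₀) x
  rw [h]
  simp

/-- **The drift flow satisfies the pressure-work hypothesis of the crux for all parameters**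
(the left-hand side is `0`, the right-hand side a product of square roots). -/
theorem pressureWork_bound_drift (Λ m M c t T : ℝ) :
    -(∫ τ in Set.Ioo 0 t, ∫ x, max (1 - c / ‖driftVel τ x‖) 0 *
        (fderiv ℝ (normalisedPressure (driftVel τ)) x (driftVel τ x))) ≤
      Real.sqrt (Λ * M ^ m * (∫⁻ τ in Set.Ioo 0 T, volume {x | c < ‖driftVel τ x‖}).toReal) *
      Real.sqrt ((∫⁻ τ in Set.Ioo 0 T, ∫⁻ x, Set.indicator {x | c < ‖driftVel τ x‖}
        (fun x => ENNReal.ofReal (‖fderiv ℝ (fun y => ‖driftVel τ y‖) x‖ ^ 2)) x).toReal) := by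
  simp_rw [pressureWork_integrand_drift]
  simp only [integral_zero, neg_zero]
  positivity

/-- **The drift flow is unbounded on `[0, 1) × ℝ³`** (`‖u(t, 0)‖ = -log(1 - t) → ∞`). -/
theorem not_bounded_drift : ¬ ∃ B : ℝ, ∀ t ∈ Set.Ico (0 : ℝ) 1, ∀ x, ‖driftVel t x‖ ≤ B := by
  rintro ⟨B, hB⟩
  have hev : ∀ᶠ t in 𝓝[<] (1 : ℝ), B < driftAmp t ∧ t ∈ Ioo (0 : ℝ) 1 :=
    (tendsto_driftAmp_atTop.eventually (eventually_gt_atTop B)).and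
      (Ioo_mem_nhdsLT (show (0 : ℝ) < 1 by norm_num))
  obtain ⟨t, hgt, ht⟩ := hev.exists
  have hle := hB t ⟨ht.1.le, ht.2⟩ 0
  have hnorm : ‖driftVel t 0‖ = |driftAmp t| := by simp [driftVel, norm_smul]
  rw [hnorm] at hle
  linarith [le_abs_self (driftAmp t)]

/-- **Any proof of `LevelSetClosure` must use the Leray–Hopf clause**: with it deleted the
statement is false, witnessed by the drift flow (`ν = T = 1`, `m = Λ = 0`, `M₀ = 1`).
[cite: KochNadirashviliSereginSverak2009, §1 p. 3 (parasitic solutions)] -/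
theorem levelSetClosure_false_without_lerayHopf : ¬ LevelSetClosureWithoutLerayHopf := fun h =>
  not_bounded_drift
    (h 1 1 one_pos one_pos driftVel driftPres (isClassical_drift 1)
      (by rw [driftVel_zero]; exact hasRapidSpatialDecay_zero) 0 0 1 (by norm_num) one_pos
      (fun x => by simp [driftVel_zero])
      (fun M c t _ _ _ _ _ => pressureWork_bound_drift 0 0 M c t 1))

end Summit.NavierStokesRegularity.NavierStokesRegularity.Theorems.LevelSetClosure.Negative

end
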